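import Literature.IUT.HodgeArakelov.LabelClassesOfCuspsCardGenuine
import Literature.IUT.HodgeArakelov.LabelClassesOfCuspsHomogeneousFaithful
import Literature.IUT.HodgeArakelov.PlusMinusTowerCoverModelCompletion
import Literature.IUT.HodgeArakelov.CoreTowerFlPMQuotient
import HarnessLib

/-!
# [IUTchII] Def 2.3 (v) at the GENUINE tower: the `𝔽^±_l`-torsor structure WITH conjugation action EXISTS on `LabCusp^±(Π̂^±_v)` —
# `Nonempty (FlTorsorStructureConj CuHat)` at the tower of record, modulo cusp separation and «the inversion reverses `Z`»

S. Mochizuki, *Inter-universal Teichmüller theory II*, kurims manuscript (Dec. 2020), §2 Def 2.3 (v) p. 69 («a natural `𝔽^±_l`-torsor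
structure on `LabCusp^±(Π_⊆)`. Moreover, the natural action of `Π_⊇/Π_⊆` on `Π_⊆` preserves this `𝔽^±_l`-torsor structure, hence determines a
natural outer isomorphism `Π_⊇/Π_⊆ ≅ 𝔽_l^{⋊±}`») [claim: Mochizuki2012, status: disputed] (IUTchII §2 Def 2.3 (v), kurims p.69)
(D-0012 claim key; record-only).  Inputs in print: [EtTh] §1 p. 12 (`Π^tp_X ↠ Z`), Def 2.1 p. 36 («`ι` … multiplication by `−1`»)
[cite: MochizukiEtTh2009, Def 2.1 p.36]; [AbsTopI] Lem 4.5 (vi) p. 55 [cite: MochizukiAbsTopI2012, Lemma 4.5 (vi) p.55];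
[SemiAnbd] Thm 6.5 (iii) p. 72 [cite: MochizukiSemiAnbd2006, Thm 6.5(iii) p.72].

abc-iut cell, seat abc-iut-w5-d132 (gen 6), rows «DEF23V-CARD-L» + NV «FlTorsorStructureConj-GENUINE» (GAP-LEDGER G-w5d243-1/2 successor
question: a GENUINE inhabitant of abc-iut-w5-d243's successor interface `FlTorsorStructureConj` at abc-iut-L6-t19's tower of record
`PlusMinusTower.ofPiCHat`, p430122, for the profinite cuspidal datum of this seat's p432649).  PROOF-ONLY (no `def`, no instance, no new
named fact).  abc-iut-w5-d243's criterion `FlTorsorStructureConj.nonempty_iff_conjStable_card_ker` (p440082) needs (i) law (a), (ii)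
`|LabCusp^±(Π̂^±_v)| = l`, (iv) faithfulness; (i)(ii) are `LabelClassesOfCuspsHomogeneousGenuine` / `LabelClassesOfCuspsCardGenuine` (mod the
ONE profinite binder `h45vi`); here (iv) is DISCHARGED by the group theory of `LabelClassesOfCuspsHomogeneousFaithful`
(`mem_pmHat_of_forall_conjClass_eq`) from ONE further printed input:

  `hR1c : ∀ w, toZ (conjX ε_± w) = (toZ w)⁻¹` — «the inversion `ι` of `C = X/±1` acts by `−1` on `Z = Gal(Y/X)`» ([EtTh] Def 2.1 p. 36;
  [IUTchII] Prop 2.2 (ii)), the (R1c) facet of GAP-LEDGER D-G-w4d010-2h (abc-iut-w5-d072 lineage: HOLDS at `MuTwoSetting.inversionModel`,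
  FAILS at the product model — a genuine input of the [EtTh] interface, not derivable from `MuTwoSetting`/`CLevelData`),

because then, for a generator `z₀` of `Z` and the inversion `g₀ ∈ Π^tp_C ∖ Π^tp_X` fixing the cusp, `ι(g₀⁻¹ z₀⁻¹ g₀ z₀) = ι(inclX(z₀ · z₀)) ∉ Π̂^±_v`
(`toZ = 2 ∉ l·ℤ`, `l` an odd prime): `Π̂^cor_v/Π̂^±_v` is dihedral, and an element fixing all `l` label classes lies in `Π̂^±_v`.

Results (with abc-iut-w4-d019's `CLevelData.toZ_conjX_of_not_mem_range`, FLSYM-GENUINE, for «every element of `Π^tp_C ∖ Π^tp_X` reverses `Z`»): `ι_comm_not_mem_closure`,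
**`mem_pmHat_of_forall_conjClass_eq_ofCoverModel`** ((iv) at the parametric tower), **`nonempty_flTorsorStructureConj_ofPiCHat`**:
`Nonempty (FlTorsorStructureConj CuHat)` at the tower of record — for EVERY cuspidal datum with the p432649 characterisation — modulo
{`h45vi` = [AbsTopI] Lem 4.5 (vi) F-0207 at the instance, `hR1c`, [SemiAnbd] Thm 6.5 (iii) F-1674 BY NAME, the parameter bundle `op`, the
origin clause «unique cusp», L02 `hZ`, `hN`}; and `exists_flTorsorStructureConj_ofPiCHat` packaging p432649's datum.

HONEST LABEL: theorems about the kernel's genuine tower over abc-iut-L2's [EtTh] interface data; the named binders are printed inputs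
carried as hypotheses, never asserted; nothing of the series is asserted; no side taken on [IUTchIII] Cor 3.12; typed ≠ proved;
witnessed ≠ endorsed; nothing here asserts abc proved or refuted.
-/

noncomputable section

namespace Literature.IUT.HodgeArakelov

open Literature.AnabelianGeometry.EtaleTheta Literature.AnabelianGeometry.SemiGraphs
open scoped Pointwise

namespace PlusMinusTower

variable {p : ℕ} [Fact p.Prime] {M : MuTwoSetting p} (e : M.CLevelData)
  {E : M.toThetaSetting.EtaleThetaData} {l : ℕ} (C : E.DoubleUnderline l) {N : ℕ+}
  (μ : M.toThetaSetting.CyclotomeMod l N) (hC : M.toThetaSetting.Compat) (hS : M.toThetaSetting.Sec2Hyps)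
  (hl : l.Prime) (hp2 : p ≠ 2) (hpl : p ≠ l) (hζ : ∃ ζ : M.toThetaSetting.K, IsPrimitiveRoot ζ (4 * l))
  {η : (C.thetaEnvData μ hC hS).PiYdd → MuN p N} (hη : η ∈ (C.thetaEnvData μ hC hS).thetaCocycles)
  {Q : Type} [Group Q] [TopologicalSpace Q] [IsTopologicalGroup Q]
  (ι : M.GtpC →ₜ* Q) (hι : IsProfiniteCompletion ι) (hinj : Function.Injective ι)
  (Φ : Q →* GQp p) (hΦ : ∀ g : M.GtpC, Φ (ι g) = e.augC g) (hΦK : Φ.range = M.GK)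
  (hZ : Thm16Sub.KerToZIsCompactlyGenerated M.toThetaSetting) (hN : (C.Huu.subgroupOf (M.GtpXu l)).Normal)
  {P : TopGroup.{0}} (T : TemperedCoverings (BadPlaceSetting.ofUnderline C μ hC hS hl hp2 hpl hζ hη) P)

/-! ## 1. (R1c) for every element of `Π^tp_C ∖ Π^tp_X`: abc-iut-w4-d019's `CLevelData.toZ_conjX_of_not_mem_range` (FLSYM-GENUINE, imported) -/

/-! ## 2. The non-commutation witness in `Q`: `ι(g₀⁻¹ z₀⁻¹ g₀ z₀) ∉ Π̂^±_v` -/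

section Witness

include e hι hl in
/-- **The quotient `Π̂^cor_v/Π̂^±_v` is NOT abelian**: for `g₀ ∈ Π^tp_C ∖ Π^tp_X` and a generator `z₀` of `Z` (`toZ z₀ = 1 ∈ ℤ`), the commutator
`ι(g₀⁻¹ · inclX(z₀)⁻¹ · g₀ · inclX z₀) = ι(inclX(conjX g₀⁻¹ (z₀⁻¹) · z₀))` has `toZ`-value `2 ∉ l·ℤ` (`l` prime `≠ 2`), hence lies OUTSIDE
`Π̂^±_v = cl ι(inclX Π^tp_{X̲})` (`ι⁻¹(Π̂^±_v) = inclX Π^tp_{X̲}`, abc-iut-w5-d139 `comap_topologicalClosure_map`). Granted `hR1c`.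
[cite: MochizukiEtTh2009, Def 2.5 (i) p.39] -/
theorem ι_comm_not_mem_closure (hl2 : l ≠ 2) (hR1c : ∀ w : M.PiTemp, M.toZ (e.conjX M.epsPM w) = (M.toZ w)⁻¹)
    {g₀ : M.GtpC} (hg₀ : g₀ ∉ M.inclX.range) {z₀ : M.PiTemp} (hz₀ : M.toZ z₀ = Multiplicative.ofAdd (1 : ℤ)) :
    ι (g₀⁻¹ * (M.inclX z₀)⁻¹ * g₀ * M.inclX z₀) ∉
      ((((M.GtpXu l).map M.inclX).map ι.toMonoidHom : Subgroup Q)).topologicalClosure := by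
  haveI : ((M.GtpXu l).map M.inclX).FiniteIndex :=
    ⟨by rw [MuTwoSetting.index_map_inclX_GtpXu]; exact mul_ne_zero two_ne_zero hl.ne_zero⟩
  intro h
  have hmem : g₀⁻¹ * (M.inclX z₀)⁻¹ * g₀ * M.inclX z₀ ∈ (M.GtpXu l).map M.inclX := by
    rw [← IsProfiniteCompletion.comap_topologicalClosure_map hι ((M.GtpXu l).map M.inclX) (isOpen_map_inclX_GtpXu e l)]
    exact h
  have heq : g₀⁻¹ * (M.inclX z₀)⁻¹ * g₀ * M.inclX z₀ = M.inclX (e.conjX g₀⁻¹ z₀⁻¹ * z₀) := by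
    rw [map_mul, e.inclX_conjX, map_inv, inv_inv]
  rw [heq, Subgroup.mem_map_iff_mem M.injective_inclX] at hmem
  -- `toZ (conjX g₀⁻¹ z₀⁻¹ · z₀) = 2`
  have hg₀' : g₀⁻¹ ∉ M.inclX.range := fun h' => hg₀ ((Subgroup.inv_mem_iff _).mp h')
  have htoZ : M.toZ (e.conjX g₀⁻¹ z₀⁻¹ * z₀) = Multiplicative.ofAdd (2 : ℤ) := by
    rw [map_mul, e.toZ_conjX_of_not_mem_range hR1c hg₀', map_inv, inv_inv, hz₀, ← ofAdd_add]
    norm_num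
  have h2 : Multiplicative.ofAdd (2 : ℤ) ∈ ThetaSetting.lZ l := by
    rw [← htoZ]; exact hmem
  obtain ⟨k, hk⟩ := Subgroup.mem_zpowers_iff.mp h2
  have hk' : (l : ℤ) * k = 2 := by
    have h' := congrArg Multiplicative.toAdd hk
    rw [toAdd_zpow, toAdd_ofAdd, toAdd_ofAdd, smul_eq_mul, mul_comm] at h'
    exact h'
  have hdvd : (l : ℤ) ∣ (2 : ℕ) := ⟨k, by rw [hk']; rfl⟩
  rw [Int.natCast_dvd_natCast] at hdvd
  rcases (Nat.dvd_prime Nat.prime_two).mp hdvd with h1 | h1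
  · exact hl.one_lt.ne' h1
  · exact hl2 h1

end Witness

/-! ## 3. Input (iv) at the genuine tower, and the successor structure -/

section Tower

variable {x₀ : M.Pt}

/-- **INPUT (iv) — FAITHFULNESS — AT THE GENUINE TOWER `ofCoverModel`**: an element of `Π̂^cor_v` fixing every `±`-label class of cusps of
`Π̂^±_v` by conjugation lies in `Π̂^±_v`, for every cuspidal datum with the p432649 characterisation; modulo the separation binder `h45vi`
([AbsTopI] Lem 4.5 (vi), F-0207 at the instance), «the inversion reverses `Z`» `hR1c` ((R1c)), F-1674, `op`, «unique cusp», `hZ`, `hN`.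
[claim: Mochizuki2012, status: disputed] (IUTchII §2 Def 2.3 (v), kurims p.69) -/
theorem mem_pmHat_of_forall_conjClass_eq_ofCoverModel (op : M.toThetaSetting.OncePuncturedData) (hx₀ : M.IsCusp x₀)
    (huniq : ∀ x' : M.Pt, M.IsCusp x' → x' = x₀) (h65iii : M.toTemperedCurve.IsoPreservesCuspidalDecomp M.toTemperedCurve)
    (h45vi : Subgroup.normalizer ((((M.toTemperedCurve.inertia x₀).map M.inclX).map ι.toMonoidHom : Subgroup Q) : Set Q) ⊓
        (M.inclX.range.map ι.toMonoidHom).topologicalClosure ≤ ((M.decomp x₀).map M.inclX).map ι.toMonoidHom)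
    (hR1c : ∀ w : M.PiTemp, M.toZ (e.conjX M.epsPM w) = (M.toZ w)⁻¹)
    (CuHat : CuspidalInertiaData (ofCoverModel e C μ hC hS hl hp2 hpl hζ hη ι hι hinj Φ hΦ hΦK hZ hN T))
    (hCu : ∀ Q' J : Subgroup (ofCoverModel e C μ hC hS hl hp2 hpl hζ hη ι hι hinj Φ hΦ hΦK hZ hN T).Corhat,
      CuHat.IsCuspidalInertia Q' J ↔ J ≤ Q' ∧ ∃ i : {x : M.Pt // M.IsCusp x} × M.GtpC,
        ∃ γ ∈ (ofCoverModel e C μ hC hS hl hp2 hpl hζ hη ι hι hinj Φ hΦ hΦK hZ hN T).pmHat,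
          J = MulAut.conj γ •
            ((((MulAut.conj i.2 • (M.toTemperedCurve.inertia i.1.1).map M.inclX) ⊓ (M.GtpXu l).map M.inclX).map
              ι.toMonoidHom : Subgroup (ofCoverModel e C μ hC hS hl hp2 hpl hζ hη ι hι hinj Φ hΦ hΦK hZ hN T).Corhat)).topologicalClosure)
    (g : (ofCoverModel e C μ hC hS hl hp2 hpl hζ hη ι hι hinj Φ hΦ hΦK hZ hN T).Corhat)
    (hg : ∀ t, (conjStable_ofCoverModel e C μ hC hS hl hp2 hpl hζ hη ι hι hinj Φ hΦ hΦK hZ hN T op hx₀ huniq CuHat hCu).conjClass g t = t) :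
    g ∈ (ofCoverModel e C μ hC hS hl hp2 hpl hζ hη ι hι hinj Φ hΦ hΦK hZ hN T).pmHat := by
  let ιW : M.GtpC →* (ofCoverModel e C μ hC hS hl hp2 hpl hζ hη ι hι hinj Φ hΦ hΦK hZ hN T).Corhat := ι.toMonoidHom
  obtain ⟨g₀, hgX, hgD⟩ := exists_ι_not_mem_closure_conj_map_decomp e ι hι hx₀ huniq h65iii
  have hg₀ : g₀ ∉ M.inclX.range := fun h => hgX ((mem_closure_range_inclX_iff ι hι g₀).mpr h)
  obtain ⟨z₀, hz₀⟩ := M.toZ_surjective (Multiplicative.ofAdd (1 : ℤ))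
  have hcomm : (ιW g₀)⁻¹ * (ιW (M.inclX z₀))⁻¹ * ιW g₀ * ιW (M.inclX z₀) ∉
      (ofCoverModel e C μ hC hS hl hp2 hpl hζ hη ι hι hinj Φ hΦ hΦK hZ hN T).pmHat := by
    rw [← map_inv, ← map_inv, ← map_mul, ← map_mul, ← map_mul]
    exact ι_comm_not_mem_closure e hl ι hι (BadPlaceSetting.ofUnderline C μ hC hS hl hp2 hpl hζ hη).l_odd hR1c hg₀ hz₀
  refine mem_pmHat_of_forall_conjClass_eq (C := CuHat)
    (J₀ := ((M.toTemperedCurve.inertia x₀).map M.inclX).map ιW)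
    (Xh := (M.inclX.range.map ιW).topologicalClosure) (D := ((M.decomp x₀).map M.inclX).map ιW) (q₁ := ιW g₀)
    ?_ (isCuspidalInertia_pmHat_iff e C μ hC hS hl hp2 hpl hζ hη ι hι hinj Φ hΦ hΦK hZ hN T op hx₀ huniq CuHat hCu)
    _ (index_closure_range_inclX ι hι) ?_ ?_ (map_decomp_le_normalizer_map_inertia ι) h45vi
    (fun q hq => conj_smul_map_inertia_of_decomp e ι Φ hΦ q hq) hgX hgD hcomm hg
  · change (((M.toTemperedCurve.inertia x₀).map M.inclX).map ι.toMonoidHom : Subgroup Q) ≤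
      (((M.GtpXu l).map M.inclX).map ι.toMonoidHom).topologicalClosure
    exact (Subgroup.map_mono (Subgroup.map_mono (inertia_le_GtpXu op hx₀))).trans (Subgroup.le_topologicalClosure _)
  · change ((((M.GtpXu l).map M.inclX).map ι.toMonoidHom).topologicalClosure : Subgroup Q) ≤
      (M.inclX.range.map ι.toMonoidHom).topologicalClosure
    exact Subgroup.topologicalClosure_mono (Subgroup.map_mono (Subgroup.map_le_range _ _))
  · change (((M.decomp x₀).map M.inclX).map ι.toMonoidHom : Subgroup Q) ≤
      (((M.GtpXu l).map M.inclX).map ι.toMonoidHom).topologicalClosure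
    exact (Subgroup.map_mono (Subgroup.map_mono (decomp_le_GtpXu op hx₀))).trans (Subgroup.le_topologicalClosure _)

end Tower

section PiCHat

variable {x₀ : M.Pt}

/-- **THE Def 2.3 (v) SUCCESSOR STRUCTURE EXISTS AT THE TOWER OF RECORD**: for every cuspidal datum `CuHat` of `ofPiCHat` with the p432649
characterisation, `Nonempty (FlTorsorStructureConj CuHat)` — an `𝔽^±_l`-torsor structure on `LabCusp^±(Π̂^±_v)` whose label action IS
conjugation, with the FORCED outer isomorphism `Π̂^cor_v/Π̂^±_v ≅ 𝔽_l^{⋊±}` (abc-iut-w5-d243's criterion, all four inputs discharged here and in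
the companions) — modulo {`h45vi` ([AbsTopI] Lem 4.5 (vi) F-0207 at the instance: cusp separation in the profinite completion), `hR1c` («the
inversion reverses `Z`», (R1c)), [SemiAnbd] Thm 6.5 (iii) F-1674, `op`, «unique cusp», L02 `hZ`, `hN`}.
[claim: Mochizuki2012, status: disputed] (IUTchII §2 Def 2.3 (v), kurims p.69) -/
theorem nonempty_flTorsorStructureConj_ofPiCHat (op : M.toThetaSetting.OncePuncturedData) (hx₀ : M.IsCusp x₀)
    (huniq : ∀ x' : M.Pt, M.IsCusp x' → x' = x₀) (h65iii : M.toTemperedCurve.IsoPreservesCuspidalDecomp M.toTemperedCurve)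
    (h45vi : Subgroup.normalizer ((((M.toTemperedCurve.inertia x₀).map M.inclX).map e.toPiCHat.toMonoidHom : Subgroup e.PiCHat) :
        Set e.PiCHat) ⊓ (M.inclX.range.map e.toPiCHat.toMonoidHom).topologicalClosure ≤
          ((M.decomp x₀).map M.inclX).map e.toPiCHat.toMonoidHom)
    (hR1c : ∀ w : M.PiTemp, M.toZ (e.conjX M.epsPM w) = (M.toZ w)⁻¹)
    (CuHat : CuspidalInertiaData (ofPiCHat e C μ hC hS hl hp2 hpl hζ hη hZ hN T))
    (hCu : ∀ Q' J : Subgroup (ofPiCHat e C μ hC hS hl hp2 hpl hζ hη hZ hN T).Corhat,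
      CuHat.IsCuspidalInertia Q' J ↔ J ≤ Q' ∧ ∃ i : {x : M.Pt // M.IsCusp x} × M.GtpC,
        ∃ γ ∈ (ofPiCHat e C μ hC hS hl hp2 hpl hζ hη hZ hN T).pmHat,
          J = MulAut.conj γ •
            ((((MulAut.conj i.2 • (M.toTemperedCurve.inertia i.1.1).map M.inclX) ⊓ (M.GtpXu l).map M.inclX).map
              e.toPiCHat.toMonoidHom : Subgroup (ofPiCHat e C μ hC hS hl hp2 hpl hζ hη hZ hN T).Corhat)).topologicalClosure) :
    Nonempty (FlTorsorStructureConj CuHat) :=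
  (nonempty_flTorsorStructureConj_ofPiCHat_iff e C μ hC hS hl hp2 hpl hζ hη hZ hN T op hx₀ huniq h65iii h45vi CuHat hCu).mpr
    (mem_pmHat_of_forall_conjClass_eq_ofCoverModel e C μ hC hS hl hp2 hpl hζ hη e.toPiCHat e.isProfiniteCompletion_toPiCHat
      e.toPiCHat_injective e.piCData.aug.toMonoidHom (fun g => e.piCData_aug_apply g) e.piCData.range_aug hZ hN T op hx₀ huniq
      h65iii h45vi hR1c CuHat hCu)

/-- **EXISTENCE FORM**: at the tower of record there IS a cuspidal datum (p432649's profinite datum: the `Π̂^±_v`-conjugates of the closures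
of the cusp family) carrying the Def 2.3 (v) successor structure — modulo the same named inputs.
[claim: Mochizuki2012, status: disputed] (IUTchII §2 Def 2.3 (v), kurims p.69) -/
theorem exists_flTorsorStructureConj_ofPiCHat (op : M.toThetaSetting.OncePuncturedData) (hx₀ : M.IsCusp x₀)
    (huniq : ∀ x' : M.Pt, M.IsCusp x' → x' = x₀) (h65iii : M.toTemperedCurve.IsoPreservesCuspidalDecomp M.toTemperedCurve)
    (h45vi : Subgroup.normalizer ((((M.toTemperedCurve.inertia x₀).map M.inclX).map e.toPiCHat.toMonoidHom : Subgroup e.PiCHat) :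
        Set e.PiCHat) ⊓ (M.inclX.range.map e.toPiCHat.toMonoidHom).topologicalClosure ≤
          ((M.decomp x₀).map M.inclX).map e.toPiCHat.toMonoidHom)
    (hR1c : ∀ w : M.PiTemp, M.toZ (e.conjX M.epsPM w) = (M.toZ w)⁻¹) :
    ∃ CuHat : CuspidalInertiaData (ofPiCHat e C μ hC hS hl hp2 hpl hζ hη hZ hN T),
      (∀ Q' J : Subgroup (ofPiCHat e C μ hC hS hl hp2 hpl hζ hη hZ hN T).Corhat,
        CuHat.IsCuspidalInertia Q' J ↔ J ≤ Q' ∧ ∃ i : {x : M.Pt // M.IsCusp x} × M.GtpC,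
          ∃ γ ∈ (ofPiCHat e C μ hC hS hl hp2 hpl hζ hη hZ hN T).pmHat,
            J = MulAut.conj γ •
              ((((MulAut.conj i.2 • (M.toTemperedCurve.inertia i.1.1).map M.inclX) ⊓ (M.GtpXu l).map M.inclX).map
                e.toPiCHat.toMonoidHom : Subgroup (ofPiCHat e C μ hC hS hl hp2 hpl hζ hη hZ hN T).Corhat)).topologicalClosure) ∧
      Nonempty (FlTorsorStructureConj CuHat) := by
  obtain ⟨CuHat, hCu, -⟩ := exists_cuspidalInertiaDataHat_ofPiCHat e C μ hC hS hl hp2 hpl hζ hη hZ hN T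
  exact ⟨CuHat, hCu, nonempty_flTorsorStructureConj_ofPiCHat e C μ hC hS hl hp2 hpl hζ hη hZ hN T op hx₀ huniq h65iii h45vi hR1c
    CuHat hCu⟩

end PiCHat

end PlusMinusTower

end Literature.IUT.HodgeArakelov

end
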